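import Summits.SmoothPoincare4.SmoothPoincare4.Theorems.ConvexBisectionAcyclicBisectionExistsSeamPageFunctionAgreement
import Summits.SmoothPoincare4.SmoothPoincare4.Theorems.ConvexBisectionAcyclicBisectionExistsSeamPageFunctionBase
import Summits.SmoothPoincare4.SmoothPoincare4.Theorems.ConvexBisectionAcyclicBisectionExistsSeamPageFunctionGlue
import Summits.SmoothPoincare4.SmoothPoincare4.Theorems.ConvexBisectionAcyclicBisectionExistsDualHandleModelImage
import HarnessLib

/-!
# The seam page function, V: `F : ∂X₁ → ℂ` — clause (ii) of T3 for the landed dual presentation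
(brick X5 of the registered stub `stub_T3_dualPresentation` (T3), line `modp-braid-orbits`, crux
`ConvexBisection.AcyclicBisectionExists`, item stmt-SmoothPoincare4-10508; wave 5, lead c5)

**`exists_seamPageFunction`**: over the T3b data (as in `…SeamPageFunctionAgreement.lean`, plus the
prefix belt equation `hB` of the compatible split, a `w ≠ 0` clause at the deep belt points of `X`
(V4 `helper_belt_pageClause`), `φ` a diffeomorphism and `jW₂` injective) there is a SMOOTH
`F : ∂X₁ → ℂ` which is a positive multiple of `w(a)` at every `X₁`-unsurgered point `incl y = D₁.jA a`
(ii-b), a positive multiple of `w(a')` at every `W₂`-unsurgered point `b₂.incl (φ y) = D₂.jA a'`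
(ii-c), whose zeros are `X₁`-unsurgered (ii-d), and with `Im(conj F · dF v) ≠ 0` for some `v` off its
zeros (ii-e).  Construction: `F := ρ₁ F₁ + ρ₂ F₂` (`…SeamPageFunctionGlue.lean`) from the two
page-angle readings `F₁ = w ∘ D₁.jA⁻¹ ∘ incl` on `U₁ = ∂X₁ ∖ (prefix belt circles)` and
`F₂ = w ∘ D₂.jA⁻¹ ∘ b₂.incl ∘ φ` on `U₂ = ∂X₁ ∖ (suffix attaching circles)`
(`…SeamPageFunctionBase.lean`), positively proportional on `U₁ ∩ U₂` by `w_agree_of_dualData`;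
`U₁ ∪ U₂ = ∂X₁` because a prefix belt point is glued, un-pushed, to the old seam off the dual tubes.
Registered helper: `helper_incl_dualMap_ne` (the old seam over a prefix handle misses the dual
tubes).  Everything here is proved; no named facts, no `def`.

## References
* A. Kas, Pacific J. Math. 89 (1980). [Kas1980]
* A. A. Kosinski, *Differential Manifolds* (1993), VI §6. [Kosinski1993]
-/

noncomputable section

-- the prescribed namespace `Summit.<P>.<Sub>.…` duplicates `SmoothPoincare4` (P = Sub)
set_option linter.dupNamespace false

open scoped Manifold ContDiff Topology

namespace Summit.SmoothPoincare4.SmoothPoincare4.Theorems.AcyclicBisectionExists.ModpBraidOrbits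

open Set Function Metric
open Literature.Topology.FourManifolds Literature.Topology.FourManifolds.HandleAttachingMap
  Literature.Topology.FourManifolds.LefschetzBase
open PushModel BeltPageClause

universe u v

/-! ### §1 The derivative clause through a diffeomorphism -/

/-- **The derivative clause transports along a diffeomorphism of `3`-manifolds** (stated at the
point `φ.symm x`; chain rule for `(F ∘ φ) ∘ φ.symm = F`). [folklore] -/
theorem exists_im_ne_zero_comp_diffeo {N : Type u} {N' : Type v} [TopologicalSpace N]
    [ChartedSpace (EuclideanSpace ℝ (Fin 3)) N] [IsManifold (𝓡 3) ∞ N] [TopologicalSpace N']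
    [ChartedSpace (EuclideanSpace ℝ (Fin 3)) N'] [IsManifold (𝓡 3) ∞ N']
    (φ : N ≃ₘ⟮𝓡 3, 𝓡 3⟯ N') {F : N' → ℂ} {x : N'} (hF : MDifferentiableAt (𝓡 3) 𝓘(ℝ, ℂ) F x)
    (h : ∃ v : EuclideanSpace ℝ (Fin 3),
      ((starRingEnd ℂ) (F x) * @id ℂ (mfderiv (𝓡 3) 𝓘(ℝ, ℂ) F x v)).im ≠ 0) :
    ∃ v : EuclideanSpace ℝ (Fin 3),
      ((starRingEnd ℂ) ((F ∘ φ) (φ.symm x)) *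
        @id ℂ (mfderiv (𝓡 3) 𝓘(ℝ, ℂ) (F ∘ φ) (φ.symm x) v)).im ≠ 0 := by
  obtain ⟨v, hv⟩ := h
  have hφd : MDifferentiableAt (𝓡 3) (𝓡 3) φ (φ.symm x) :=
    φ.contMDiff.contMDiffAt.mdifferentiableAt (by simp)
  have hφsd : MDifferentiableAt (𝓡 3) (𝓡 3) φ.symm x :=
    φ.symm.contMDiff.contMDiffAt.mdifferentiableAt (by simp)
  have hF' : MDifferentiableAt (𝓡 3) 𝓘(ℝ, ℂ) F (φ (φ.symm x)) := by rwa [φ.apply_symm_apply]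
  have hFφ : MDifferentiableAt (𝓡 3) 𝓘(ℝ, ℂ) (F ∘ φ) (φ.symm x) := hF'.comp (φ.symm x) hφd
  have hfun : ((F ∘ φ) ∘ φ.symm) = F := funext fun z => by simp [φ.apply_symm_apply]
  have hc : @id ℂ (mfderiv (𝓡 3) 𝓘(ℝ, ℂ) (F ∘ φ) (φ.symm x) (mfderiv (𝓡 3) (𝓡 3) φ.symm x v)) =
      @id ℂ (mfderiv (𝓡 3) 𝓘(ℝ, ℂ) F x v) := by
    have h1 := mfderiv_comp x hFφ hφsd
    rw [hfun] at h1
    rw [h1]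
    rfl
  refine ⟨mfderiv (𝓡 3) (𝓡 3) φ.symm x v, ?_⟩
  rw [hc, comp_apply, φ.apply_symm_apply]
  exact hv

/-! ### §2 The seam page function -/

section SeamPageFunction

variable {g : ℕ} {ι : Type} [Finite ι] {h : ι → HandleAttachingMap 3 2 (Base g)}
  {X : Type} [TopologicalSpace X] [ChartedSpace (EuclideanHalfSpace 4) X] [IsManifold (𝓡∂ 4) ∞ X]
  {bX : BoundaryData (𝓡∂ 4) X (𝓡 3)} [Nonempty bX.carrier]
  {ι₁ : Type} [Finite ι₁] {ι' : Type} [Finite ι']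
  {X₁ : Type} [TopologicalSpace X₁] [T2Space X₁] [CompactSpace X₁] [ChartedSpace (EuclideanHalfSpace 4) X₁]
  [IsManifold (𝓡∂ 4) ∞ X₁]
  {W₂ : Type} [TopologicalSpace W₂] [ChartedSpace (EuclideanHalfSpace 4) W₂]

omit [Nonempty bX.carrier] [Finite ι₁] [Finite ι'] [T2Space X₁] [CompactSpace X₁]
  [IsManifold (𝓡∂ 4) ∞ X₁] in
/-- **The old seam over a PREFIX handle misses the dual tubes**: if `bX.incl z = D.jB (e i) b` then
`(bBase g).incl (G.φ z)` is not in the range of any dual attaching map `dualMap … (f j)` (a dual tube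
meets `∂ Base g` in `G.φ` of SUFFIX belt-tube sphere points, and the handles of `X` are disjoint).
[cite: Kosinski1993, VI §6] -/
theorem incl_dualMap_ne [Nonempty bX.carrier] (D : MultiAttachmentData h (𝓡∂ 4) X)
    (G : BoundaryGlueData bX (bBase g)) (e : ι₁ → ι) (f : ι' → ι)
    (hdisj : ∀ (j : ι') (i : ι₁), Disjoint (range (h (f j)).toFun) (range (h (e i)).toFun))
    {aC κ δ : ℝ} (ha : 0 < aC) (hκ : 0 < κ) (hκ2 : κ ≤ 1 / 2) (hκ1 : κ ≤ 1) (hδ : 0 < δ)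
    (hδ2 : δ ≤ 1 / 2) (col : (BoundaryManifold.boundaryData 3 (Base g)).Collar)
    (hCM : ∀ j, CollarAdapted D (f j) G aC)
    (hcol : ∀ (w : (BoundaryManifold.boundaryData 3 (Base g)).carrier) (x : (bBase g).carrier),
      (BoundaryManifold.boundaryData 3 (Base g)).incl w = (bBase g).incl x →
      ∀ t : Set.Icc (0 : ℝ) 1, col.toFun (w, t) = G.CN.toFun x ((t : ℝ) / (2 - t)))
    (i : ι₁) (b : ↥(beltPiece 3 2)) (z : bX.carrier) (hz : bX.incl z = D.jB (e i) b)
    (j : ι') (y' : ↥(handleTube 3 2)) :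
    (dualMap D bX (bBase g) G.φ col κ δ hκ hκ1 hδ hδ2 (f j)).toFun y' ≠ (bBase g).incl (G.φ z) := by
  intro heq
  have hb : ((bBase g).incl (G.φ z) : Base g) ∈ (𝓡∂ 4).boundary (Base g) := by
    rw [← (bBase g).range_incl]; exact mem_range_self _
  have hd : tubeDepth y' = 0 := by
    rw [tubeDepth_eq_zero_iff]; exact norm_eq_one_of_apply_mem_boundary _ y' (heq ▸ hb)
  obtain ⟨bW, -, hbW⟩ := jN_dualMap_of_depth_zero D G f ha hκ hκ2 hκ1 hδ hδ2 col hCM hcol j y' hd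
  have hMN : G.jM (D.jB (e i) b) = G.jN ((bBase g).incl (G.φ z)) := by
    rw [← hz]; exact G.jM_eq_jN_iff.2 ⟨z, rfl, rfl⟩
  rw [← heq, hbW] at hMN
  have hij : e i = f j := by
    by_contra hne
    have heq' := G.injective_jM hMN
    exact Set.disjoint_left.1 (D.disjointB hne) (mem_range_self b) (by rw [heq']; exact mem_range_self bW)
  have hself := hdisj j i
  rw [← hij, Set.disjoint_iff_inter_eq_empty, inter_self] at hself
  exact (range_eq_empty_iff.1 hself).false y'

omit [Finite ι₁] [Finite ι'] [T2Space X₁] [CompactSpace X₁] [IsManifold (𝓡∂ 4) ∞ X₁] in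
/-- **X1's export (E2) in the handle chart**: if `JB j b = gluedHandleChart D (f j) G a (modelF a κ δ b)` for all
belt piece points `b`, then `JB j zb = jM (D.jB (f j) b)` whenever `b = modelF a κ δ zb` is itself a belt piece
point — such a `b` lies in the chart domain (in the open ball, or on the sphere with `‖b_λ‖² < κ²` since
`modelF (D⁴ ∖ S) = Dome ∪ N`, Z2), where the glued chart is the handle chart (Y6 `gluedHandleChart_coe`).
[cite: Kosinski1993, VI §6] -/
theorem apply_eq_jM_jB_of_gluedHandleChart (D : MultiAttachmentData h (𝓡∂ 4) X)
    (G : BoundaryGlueData bX (bBase g)) (f : ι' → ι) {aC κ δ : ℝ} (ha : 0 < aC) (hκ : 0 < κ)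
    (hκ2 : κ ≤ 1 / 2) (hδ : 0 < δ) (hδ2 : δ ≤ 1 / 2) (hCM : ∀ j, CollarAdapted D (f j) G aC)
    (JB : ι' → ↥(beltPiece 3 2) → G.d₂.Glued)
    (hE2 : ∀ (j : ι') (b : ↥(beltPiece 3 2)), JB j b = gluedHandleChart D (f j) G aC
      (modelF aC κ δ ((b : closedBall (0 : EuclideanSpace ℝ (Fin 4)) 1) : EuclideanSpace ℝ (Fin 4))))
    (j : ι') (zb b : ↥(beltPiece 3 2))
    (hb : ((b : closedBall (0 : EuclideanSpace ℝ (Fin 4)) 1) : EuclideanSpace ℝ (Fin 4)) =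
      modelF aC κ δ ((zb : closedBall (0 : EuclideanSpace ℝ (Fin 4)) 1) : EuclideanSpace ℝ (Fin 4))) :
    JB j zb = G.jM (D.jB (f j) b) := by
  rw [hE2, ← hb]
  apply gluedHandleChart_coe D (f j) G ha (hCM j) b
  have hzb1 : ‖((zb : closedBall (0 : EuclideanSpace ℝ (Fin 4)) 1) : EuclideanSpace ℝ (Fin 4))‖ ≤ 1 :=
    mem_closedBall_zero_iff.1 zb.1.2
  have hzbS : sOf ((zb : closedBall (0 : EuclideanSpace ℝ (Fin 4)) 1) : EuclideanSpace ℝ (Fin 4)) < 1 := by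
    rw [sOf_eq_lamSq]
    refine lt_of_le_of_ne ?_ zb.2
    have := lamSq_add_muSq 2 ((zb : closedBall (0 : EuclideanSpace ℝ (Fin 4)) 1) : EuclideanSpace ℝ (Fin 4))
    nlinarith [muSq_nonneg 2 ((zb : closedBall (0 : EuclideanSpace ℝ (Fin 4)) 1) : EuclideanSpace ℝ (Fin 4)),
      norm_nonneg ((zb : closedBall (0 : EuclideanSpace ℝ (Fin 4)) 1) : EuclideanSpace ℝ (Fin 4))]
  have himg : ((b : closedBall (0 : EuclideanSpace ℝ (Fin 4)) 1) : EuclideanSpace ℝ (Fin 4)) ∈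
      dualDome aC κ δ ∪ cocoreNbhd κ δ := by
    rw [← image_modelF_eq ha hκ hκ2 hδ hδ2, hb]
    exact mem_image_of_mem _ ⟨hzb1, hzbS⟩
  have hb1 : ‖((b : closedBall (0 : EuclideanSpace ℝ (Fin 4)) 1) : EuclideanSpace ℝ (Fin 4))‖ ≤ 1 :=
    mem_closedBall_zero_iff.1 b.1.2
  have hκ' : κ ^ 2 ≤ 1 / 4 := by nlinarith
  have hP : ‖lamPart ((b : closedBall (0 : EuclideanSpace ℝ (Fin 4)) 1) : EuclideanSpace ℝ (Fin 4))‖ ^ 2 < 1 / 4 := by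
    rcases himg with hD | hN
    · have := hD.1; nlinarith
    · have := lamSq_le_of_mem_cocoreNbhd hδ hN; nlinarith
  by_cases h1 : ‖((b : closedBall (0 : EuclideanSpace ℝ (Fin 4)) 1) : EuclideanSpace ℝ (Fin 4))‖ < 1
  · exact Or.inl (mem_ball_zero_iff.2 h1)
  · right
    have heq1 : ‖((b : closedBall (0 : EuclideanSpace ℝ (Fin 4)) 1) : EuclideanSpace ℝ (Fin 4))‖ = 1 :=
      le_antisymm hb1 (not_lt.1 h1)
    refine ⟨?_, ?_, ?_⟩
    · intro h0
      have := norm_sq_eq_lamPart_muPart ((b : closedBall (0 : EuclideanSpace ℝ (Fin 4)) 1) : EuclideanSpace ℝ (Fin 4))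
      rw [heq1, h0, norm_zero] at this
      nlinarith
    · nlinarith [norm_nonneg (lamPart ((b : closedBall (0 : EuclideanSpace ℝ (Fin 4)) 1) : EuclideanSpace ℝ (Fin 4)))]
    · rw [heq1, one_pow, sub_self, abs_zero]
      exact lt_min (by norm_num) ha

/-- **THE SEAM PAGE FUNCTION (clause (ii) of T3 for the landed dual presentation).**
[cite: Kas1980] -/
theorem exists_seamPageFunction (D : MultiAttachmentData h (𝓡∂ 4) X) (G : BoundaryGlueData bX (bBase g))
    (e : ι₁ → ι) (f : ι' → ι) (hf : Injective f) (hef : ∀ i, i ∈ range e ∨ i ∈ range f)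
    (hdisj : ∀ (j : ι') (i : ι₁), Disjoint (range (h (f j)).toFun) (range (h (e i)).toFun))
    (D₁ : MultiAttachmentData (fun i => h (e i)) (𝓡∂ 4) X₁)
    (D₂' : MultiAttachmentData (fun j => D₁.lift (h (f j)) (hdisj j)) (𝓡∂ 4) X)
    (hA : ∀ (a : ↥(coresComplement h)) (ha₁ : (a : Base g) ∈ coresComplement fun i => h (e i))
      (ha₂ : D₁.jA ⟨a, ha₁⟩ ∈ coresComplement fun j => D₁.lift (h (f j)) (hdisj j)),
      D₂'.jA ⟨D₁.jA ⟨a, ha₁⟩, ha₂⟩ = D.jA a)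
    (hB : ∀ (i : ι₁) (b : ↥(beltPiece 3 2))
      (hb : D₁.jB i b ∈ coresComplement fun j => D₁.lift (h (f j)) (hdisj j)),
      D₂'.jA ⟨D₁.jB i b, hb⟩ = D.jB (e i) b)
    (hC : ∀ (j : ι') (b : ↥(beltPiece 3 2)), D₂'.jB j b = D.jB (f j) b)
    {aC κ δ : ℝ} (ha : 0 < aC) (hκ : 0 < κ) (hκ2 : κ ≤ 1 / 2) (hκ1 : κ ≤ 1) (hδ : 0 < δ)
    (hδ2 : δ ≤ 1 / 2) (col : (BoundaryManifold.boundaryData 3 (Base g)).Collar)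
    (hCM : ∀ j, CollarAdapted D (f j) G aC)
    (hcol : ∀ (w : (BoundaryManifold.boundaryData 3 (Base g)).carrier) (x : (bBase g).carrier),
      (BoundaryManifold.boundaryData 3 (Base g)).incl w = (bBase g).incl x →
      ∀ t : Set.Icc (0 : ℝ) 1, col.toFun (w, t) = G.CN.toFun x ((t : ℝ) / (2 - t)))
    {jX₁ : X₁ → G.d₂.Glued}
    (hYa : ∀ (p : X₁) (hp : p ∈ coresComplement fun j => D₁.lift (h (f j)) (hdisj j)),
      (∀ (j : ι') (y : ↥(handleTube 3 2)), (D₁.lift (h (f j)) (hdisj j)).toFun y = p →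
        ‖lamPart ((y : closedBall (0 : EuclideanSpace ℝ (Fin 4)) 1) : EuclideanSpace ℝ (Fin 4))‖ ^ 2 ≤
          1 - 3 * κ ^ 2 / 4) →
      jX₁ p = G.jM (D₂'.jA ⟨p, hp⟩))
    (hYb : ∀ (j : ι') (y : ↥(handleTube 3 2)) (b : ↥(beltPiece 3 2)),
      ((b : closedBall (0 : EuclideanSpace ℝ (Fin 4)) 1) : EuclideanSpace ℝ (Fin 4)) =
        handleInversion 2 (selfPush κ δ
          ((y : closedBall (0 : EuclideanSpace ℝ (Fin 4)) 1) : EuclideanSpace ℝ (Fin 4))) →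
      jX₁ ((D₁.lift (h (f j)) (hdisj j)).toFun y) = G.jM (D₂'.jB j b))
    (b₂ : BoundaryData (𝓡∂ 4) W₂ (𝓡 3)) {jW₂ : W₂ → G.d₂.Glued} (hjW₂ : Injective jW₂)
    (φ : (BoundaryManifold.boundaryData 3 X₁).carrier ≃ₘ⟮𝓡 3, 𝓡 3⟯ b₂.carrier)
    (hseamId : ∀ z, jW₂ (b₂.incl (φ z)) = jX₁ ((BoundaryManifold.boundaryData 3 X₁).incl z))
    (D₂ : MultiAttachmentData
      (fun j : ι' => dualMap D bX (bBase g) G.φ col κ δ hκ hκ1 hδ hδ2 (f j)) (𝓡∂ 4) W₂)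
    (hE1 : ∀ (w : Base g)
      (hw : w ∈ coresComplement fun j : ι' => dualMap D bX (bBase g) G.φ col κ δ hκ hκ1 hδ hδ2 (f j)),
      (∀ (j : ι') (y : ↥(handleTube 3 2)),
        (dualMap D bX (bBase g) G.φ col κ δ hκ hκ1 hδ hδ2 (f j)).toFun y ≠ w) →
      jW₂ (D₂.jA ⟨w, hw⟩) = G.jN w)
    (hE2 : ∀ (j : ι') (b : ↥(beltPiece 3 2)), jW₂ (D₂.jB j b) = gluedHandleChart D (f j) G aC
      (modelF aC κ δ ((b : closedBall (0 : EuclideanSpace ℝ (Fin 4)) 1) : EuclideanSpace ℝ (Fin 4))))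
    (hpage : ∀ (y : bX.carrier) (a : ↥(coresComplement h)), bX.incl y = D.jA a →
      ∃ c : ℝ, 0 < c ∧ w g ((bBase g).incl (G.φ y)).1 = (c : ℂ) * w g (a : Base g).1)
    (hbelt : ∀ (y : bX.carrier) (k : ι) (b : ↥(beltPiece 3 2)), bX.incl y = D.jB k b →
      bX.incl y ∉ range D.jA → w g ((bBase g).incl (G.φ y)).1 ≠ 0) :
    ∃ F : (BoundaryManifold.boundaryData 3 X₁).carrier → ℂ,
      ContMDiff (𝓡 3) 𝓘(ℝ, ℂ) ∞ F ∧
      (∀ (y : (BoundaryManifold.boundaryData 3 X₁).carrier) (a : ↥(coresComplement fun i => h (e i))),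
        (BoundaryManifold.boundaryData 3 X₁).incl y = D₁.jA a →
        ∃ c : ℝ, 0 < c ∧ F y = c * w g (a : Base g).1) ∧
      (∀ (y : (BoundaryManifold.boundaryData 3 X₁).carrier)
        (a' : ↥(coresComplement fun j : ι' => dualMap D bX (bBase g) G.φ col κ δ hκ hκ1 hδ hδ2 (f j))),
        b₂.incl (φ y) = D₂.jA a' → ∃ c : ℝ, 0 < c ∧ F y = c * w g (a' : Base g).1) ∧
      (∀ y, F y = 0 → ∃ a : ↥(coresComplement fun i => h (e i)),
        (BoundaryManifold.boundaryData 3 X₁).incl y = D₁.jA a) ∧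
      (∀ y, F y ≠ 0 → ∃ v : EuclideanSpace ℝ (Fin 3),
        ((starRingEnd ℂ) (F y) * @id ℂ (mfderiv (𝓡 3) 𝓘(ℝ, ℂ) F y v)).im ≠ 0) := by
  classical
  -- X1's (E2) in the handle chart
  have hF1 : ∀ (j : ι') (zb b : ↥(beltPiece 3 2)),
      ((b : closedBall (0 : EuclideanSpace ℝ (Fin 4)) 1) : EuclideanSpace ℝ (Fin 4)) =
        modelF aC κ δ ((zb : closedBall (0 : EuclideanSpace ℝ (Fin 4)) 1) : EuclideanSpace ℝ (Fin 4)) →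
      jW₂ (D₂.jB j zb) = G.jM (D.jB (f j) b) := fun j zb b hb =>
    apply_eq_jM_jB_of_gluedHandleChart D G f ha hκ hκ2 hδ hδ2 hCM (fun j b => jW₂ (D₂.jB j b)) hE2 j zb b hb
  -- instances on `∂X₁`
  haveI : T2Space (BoundaryManifold.boundaryData 3 X₁).carrier :=
    inferInstanceAs (T2Space ((𝓡∂ 4).boundary X₁))
  have hcl : IsClosed ((𝓡∂ 4).boundary X₁) :=
    ModelWithCorners.isClosed_boundary (I := 𝓡∂ 4) (M := X₁) (n := (∞ : WithTop ℕ∞)) (by simp)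
  haveI : CompactSpace ((𝓡∂ 4).boundary X₁) := isCompact_iff_compactSpace.1 hcl.isCompact
  haveI : CompactSpace (BoundaryManifold.boundaryData 3 X₁).carrier :=
    inferInstanceAs (CompactSpace ((𝓡∂ 4).boundary X₁))
  -- the two page-angle readings
  obtain ⟨F₁, hv₁, hs₁, hd₁⟩ := exists_seamReading D₁ (BoundaryManifold.boundaryData 3 X₁)
  obtain ⟨F₂', hv₂, hs₂, hd₂⟩ := exists_seamReading D₂ b₂
  have hU₁ : IsOpen {y : (BoundaryManifold.boundaryData 3 X₁).carrier |
      (BoundaryManifold.boundaryData 3 X₁).incl y ∈ range D₁.jA} := isOpen_seamSet D₁ _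
  have hU₂ : IsOpen {y : (BoundaryManifold.boundaryData 3 X₁).carrier | b₂.incl (φ y) ∈ range D₂.jA} :=
    (isOpen_seamSet D₂ b₂).preimage φ.continuous
  have hs₂' : ContMDiffOn (𝓡 3) 𝓘(ℝ, ℂ) ∞ (F₂' ∘ φ)
      {y : (BoundaryManifold.boundaryData 3 X₁).carrier | b₂.incl (φ y) ∈ range D₂.jA} :=
    hs₂.comp φ.contMDiff.contMDiffOn fun y hy => hy
  -- a PREFIX BELT point of `∂X₁` is `W₂`-unsurgered, over a point of `∂ Base g` off the binding
  have hbeltpt : ∀ y : (BoundaryManifold.boundaryData 3 X₁).carrier,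
      (BoundaryManifold.boundaryData 3 X₁).incl y ∉ range D₁.jA →
      ∃ a' : ↥(coresComplement fun j : ι' => dualMap D bX (bBase g) G.φ col κ δ hκ hκ1 hδ hδ2 (f j)),
        D₂.jA a' = b₂.incl (φ y) ∧ w g (a' : Base g).1 ≠ 0 := by
    intro y h1
    rcases D₁.mem_range_or ((BoundaryManifold.boundaryData 3 X₁).incl y) with ⟨a, ha⟩ | ⟨i, b, hb⟩
    · exact absurd ⟨a, ha⟩ h1
    have hpc : (BoundaryManifold.boundaryData 3 X₁).incl y ∈
        coresComplement fun j => D₁.lift (h (f j)) (hdisj j) := by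
      rw [mem_coresComplement]
      intro j hj
      obtain ⟨t, -, ht⟩ := (mem_core_iff _).1 hj
      rw [MultiAttachmentData.lift_apply] at ht
      exact h1 ⟨_, ht⟩
    have hX : jX₁ ((BoundaryManifold.boundaryData 3 X₁).incl y) = G.jM (D.jB (e i) b) := by
      rw [hYa _ hpc]
      · congr 1
        have hpc' : D₁.jB i b ∈ coresComplement fun j => D₁.lift (h (f j)) (hdisj j) := hb ▸ hpc
        rw [← hB i b hpc']
        congr 1
        exact Subtype.ext hb.symm
      · intro j t ht
        exfalso
        rw [MultiAttachmentData.lift_apply] at ht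
        exact h1 ⟨_, ht⟩
    have hbn : ‖((b : closedBall (0 : EuclideanSpace ℝ (Fin 4)) 1) : EuclideanSpace ℝ (Fin 4))‖ = 1 :=
      norm_eq_one_of_jB_mem_boundary D₁ i b
        (by rw [hb, ← (BoundaryManifold.boundaryData 3 X₁).range_incl]; exact mem_range_self y)
    have hbd : D.jB (e i) b ∈ (𝓡∂ 4).boundary X := jB_mem_boundary_of_norm_eq_one D (e i) b hbn
    rw [← bX.range_incl] at hbd
    obtain ⟨z, hz⟩ := hbd
    have hoff := incl_dualMap_ne D G e f hdisj ha hκ hκ2 hκ1 hδ hδ2 col hCM hcol i b z hz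
    have hw : ((bBase g).incl (G.φ z) : Base g) ∈
        coresComplement fun j : ι' => dualMap D bX (bBase g) G.φ col κ δ hκ hκ1 hδ hδ2 (f j) := by
      rw [mem_coresComplement]
      intro j hj
      obtain ⟨t, -, ht⟩ := (mem_core_iff _).1 hj
      exact hoff j t ht
    have hE := hE1 _ hw hoff
    have hMN : G.jM (D.jB (e i) b) = G.jN ((bBase g).incl (G.φ z)) := by
      rw [← hz]; exact G.jM_eq_jN_iff.2 ⟨z, rfl, rfl⟩
    -- `D.jB (e i) b` is a deep belt point of `X`: `b_λ = 0`
    have hb0 : lamSq 2 ((b : closedBall (0 : EuclideanSpace ℝ (Fin 4)) 1) : EuclideanSpace ℝ (Fin 4)) = 0 :=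
      lamSq_eq_zero_of_not_mem_range_jA D₁ i b (hb ▸ h1)
    have hdeep : bX.incl z ∉ range D.jA := by
      rintro ⟨a₀, ha₀⟩
      rw [hz] at ha₀
      exact ((D.glue (e i) a₀ b).1 ha₀).lamSq_ne_zero hb0
    refine ⟨⟨_, hw⟩, hjW₂ ?_, hbelt z (e i) b hz hdeep⟩
    rw [hE, ← hMN, ← hX, hseamId]
  -- the cover
  have hcov : {y : (BoundaryManifold.boundaryData 3 X₁).carrier |
      (BoundaryManifold.boundaryData 3 X₁).incl y ∈ range D₁.jA} ∪
      {y | b₂.incl (φ y) ∈ range D₂.jA} = univ := by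
    refine eq_univ_of_forall fun y => ?_
    by_cases h1 : (BoundaryManifold.boundaryData 3 X₁).incl y ∈ range D₁.jA
    · exact Or.inl h1
    · obtain ⟨a', ha', -⟩ := hbeltpt y h1
      exact Or.inr ⟨a', ha'⟩
  -- agreement on the overlap
  have hagree : ∀ y ∈ {y : (BoundaryManifold.boundaryData 3 X₁).carrier |
      (BoundaryManifold.boundaryData 3 X₁).incl y ∈ range D₁.jA} ∩ {y | b₂.incl (φ y) ∈ range D₂.jA},
      ∃ c : ℝ, 0 < c ∧ (F₂' ∘ φ) y = c * F₁ y := by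
    rintro y ⟨⟨a, hya⟩, ⟨a', hya'⟩⟩
    obtain ⟨c, hc, hcw⟩ := w_agree_of_dualData D G e f hf hef hdisj D₁ D₂' hA hC ha hκ hκ2 hκ1 hδ hδ2
      col hCM hcol hYa hYb b₂ jW₂ φ hseamId D₂ hE1 hF1 hpage y a a' hya.symm hya'.symm
    exact ⟨c, hc, by rw [comp_apply, hv₂ _ a' hya'.symm, hv₁ y a hya.symm, hcw]⟩
  -- glue
  obtain ⟨F, hFs, hP₁, hP₂, hD₁, hD₂⟩ := exists_glue_pageReadings hU₁ hU₂ hcov hs₁ hs₂' hagree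
  refine ⟨F, hFs, ?_, ?_, ?_, ?_⟩
  · intro y a hy
    obtain ⟨c, hc, hcy⟩ := hP₁ y ⟨a, hy.symm⟩
    exact ⟨c, hc, by rw [hcy, hv₁ y a hy]⟩
  · intro y a' hy
    obtain ⟨c, hc, hcy⟩ := hP₂ y ⟨a', hy.symm⟩
    exact ⟨c, hc, by rw [hcy, comp_apply, hv₂ _ a' hy]⟩
  · intro y hy0
    by_contra hno
    have h1 : (BoundaryManifold.boundaryData 3 X₁).incl y ∉ range D₁.jA := fun ⟨a, ha⟩ => hno ⟨a, ha.symm⟩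
    obtain ⟨a', ha', hw⟩ := hbeltpt y h1
    obtain ⟨c, hc, hcy⟩ := hP₂ y ⟨a', ha'⟩
    rw [hy0, comp_apply, hv₂ _ a' ha'.symm] at hcy
    exact mul_ne_zero (Complex.ofReal_ne_zero.2 hc.ne') hw hcy.symm
  · intro y hFy
    by_cases h1 : (BoundaryManifold.boundaryData 3 X₁).incl y ∈ range D₁.jA
    · obtain ⟨a, ha⟩ := h1
      obtain ⟨c, hc, hcy⟩ := hP₁ y ⟨a, ha⟩
      have hF₁ : F₁ y ≠ 0 := by
        intro h0; rw [h0, mul_zero] at hcy; exact hFy hcy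
      have hw : w g (a : Base g).1 ≠ 0 := by rwa [hv₁ y a ha.symm] at hF₁
      exact hD₁ y ⟨a, ha⟩ hF₁ (hd₁ y a ha.symm hw)
    · obtain ⟨a', ha', hw⟩ := hbeltpt y h1
      have hyU : y ∈ {y : (BoundaryManifold.boundaryData 3 X₁).carrier | b₂.incl (φ y) ∈ range D₂.jA} :=
        ⟨a', ha'⟩
      have hF₂ : (F₂' ∘ φ) y ≠ 0 := by rw [comp_apply, hv₂ _ a' ha'.symm]; exact hw
      have hdiff : MDifferentiableAt (𝓡 3) 𝓘(ℝ, ℂ) F₂' (φ y) :=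
        (hs₂.contMDiffAt ((isOpen_seamSet D₂ b₂).mem_nhds (show b₂.incl (φ y) ∈ range D₂.jA from
          ⟨a', ha'⟩))).mdifferentiableAt (by simp)
      have key := exists_im_ne_zero_comp_diffeo φ hdiff (hd₂ (φ y) a' ha'.symm hw)
      rw [φ.symm_apply_apply] at key
      exact hD₂ y hyU hF₂ key

end SeamPageFunction

/-! ### Registered helper -/

/-- **Registered helper `helper_exists_im_ne_zero_comp_diffeo` (anchor of this file; sub-goal of
`stub_T3_dualPresentation`, T3 clause (ii), wave 5, lead c5): the derivative clause
`∃ v, Im(conj F · dF v) ≠ 0` transports along a diffeomorphism of `3`-manifolds.**  (The main theorem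
`exists_seamPageFunction` of this file is too long to register; it rides along.) [folklore] -/
theorem helper_exists_im_ne_zero_comp_diffeo : ∀ {N : Type} {N' : Type} [TopologicalSpace N] [ChartedSpace (EuclideanSpace ℝ (Fin 3)) N] [IsManifold (𝓡 3) ∞ N] [TopologicalSpace N'] [ChartedSpace (EuclideanSpace ℝ (Fin 3)) N'] [IsManifold (𝓡 3) ∞ N'] (φ : N ≃ₘ⟮𝓡 3, 𝓡 3⟯ N') {F : N' → ℂ} {x : N'}, MDifferentiableAt (𝓡 3) 𝓘(ℝ, ℂ) F x → (∃ v : EuclideanSpace ℝ (Fin 3), ((starRingEnd ℂ) (F x) * @id ℂ (mfderiv (𝓡 3) 𝓘(ℝ, ℂ) F x v)).im ≠ 0) → ∃ v : EuclideanSpace ℝ (Fin 3), ((starRingEnd ℂ) ((F ∘ φ) (φ.symm x)) * @id ℂ (mfderiv (𝓡 3) 𝓘(ℝ, ℂ) (F ∘ φ) (φ.symm x) v)).im ≠ 0 :=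
  fun φ _ _ hF h => exists_im_ne_zero_comp_diffeo φ hF h


end Summit.SmoothPoincare4.SmoothPoincare4.Theorems.AcyclicBisectionExists.ModpBraidOrbits

end
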